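import Mathlib.Analysis.Calculus.FDeriv.Symmetric
import Mathlib.Analysis.Calculus.ContDiff.Deriv
import Mathlib.Analysis.Calculus.ContDiff.Bounds
import Mathlib.Analysis.InnerProductSpace.Calculus
import Literature.Analysis.FluidPDE.StationaryEulerStates
import HarnessLib

/-!
# Localized plane waves for the stationary Euler subsolution system: second-order potentials
(Choffrut–Székelyhidi 2014, Lemma 3)

Topic `Literature/Analysis/FluidPDE`. Support file of the proof of
`Literature.Analysis.FluidPDE.Torus.ChoffrutSzekelyhidi2014_thm1` (Choffrut–Székelyhidi, SIAM
J. Math. Anal. 46 (2014) = arXiv:1401.4301). Lemma 3 of the paper (= De Lellis–Székelyhidi 2009,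
Prop. 3.2 restricted to time-independent potentials; Székelyhidi–Wiedemann 2012, Prop. 20):
for every wave direction `w̄ = (v̄, ū)` with certificate `(η, q)` — `v̄ · η = 0`,
`S̄ η = 0` for `S̄ := ū + q Id` — there is a homogeneous second-order constant-coefficient
operator `𝓛_w̄` mapping scalar functions `φ` on `ℝ^d` to smooth solutions `(v, u)` of the linear
system `div v = 0`, `div (u + p Id) = 0` (for a suitable `p`), with `𝓛_w̄[H(x·η)] = w̄ H''(x·η)`.

We give `𝓛_w̄` explicitly ("double-curl" potentials):
* `v_i = Σ_{k,l} P_{ikl} ∂_k∂_l φ` with `P_{ikl} = ψ̄_{ik} η_l / |η|²`,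
  `ψ̄ = (v̄ ⊗ η - η ⊗ v̄)/|η|²` antisymmetric — so `div v = 0` by the symmetry of second
  derivatives, and `Σ_{kl} P_{ikl} η_k η_l = v̄_i`;
* `S_{ij} = Σ_{k,l} Φ_{ikjl} ∂_k∂_l φ` with the Kulkarni–Nomizu-type tensor
  `Φ_{ikjl} = (S̄_{ij} η_k η_l - S̄_{kj} η_i η_l - S̄_{il} η_k η_j + S̄_{kl} η_i η_j)/|η|⁴`,
  antisymmetric in `(j, l)` and pair-symmetric — so `S` is symmetric, `div S = 0` row-wise, and
  `Σ_{kl} Φ_{ikjl} η_k η_l = S̄_{ij}`; the stress is `u = S - (tr S / d) Id` (`p = tr S / d`).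

Contents: a small calculus kit on `ℝ^d` (directional derivatives `pd`, Schwarz, Leibniz, chain
rule along a linear phase), the certificates `WaveCert`, the operator (`velPot`, `strS`,
`strPot`, `field`), its smoothness/support, the two conservation laws, admissibility of its
values, and the plane-wave contraction identities.

## References

* A. Choffrut, L. Székelyhidi Jr., SIAM J. Math. Anal. 46 (2014), Lemma 3.
* C. De Lellis, L. Székelyhidi Jr., Ann. of Math. 170 (2009), Prop. 3.2 / Lemma 3.3.
* L. Székelyhidi Jr., E. Wiedemann, Arch. Ration. Mech. Anal. 206 (2012), Prop. 20.
-/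

noncomputable section

open scoped InnerProductSpace Matrix ContDiff
open Set Function

namespace Literature.Analysis.FluidPDE

namespace StationaryEuler

variable {d : Type*} [Fintype d] [DecidableEq d]

/-! ## Calculus kit on `ℝ^d` -/

variable (d) in
/-- Physical space `ℝ^d`. [folklore] -/
abbrev Ed : Type _ := EuclideanSpace ℝ d

/-- The coordinate direction `e_i`. [folklore] -/
abbrev eb (i : d) : Ed d := EuclideanSpace.single i (1 : ℝ)

/-- Directional derivative of a scalar function: `∂_v f (x) = Df(x) v`. [folklore] -/
def pd (v : Ed d) (f : Ed d → ℝ) : Ed d → ℝ := fun x => fderiv ℝ f x v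

omit [Fintype d] [DecidableEq d] in
/-- Unfolding of `pd`. [folklore] -/
theorem pd_apply (v : Ed d) (f : Ed d → ℝ) (x : Ed d) : pd v f x = fderiv ℝ f x v := rfl

section Calculus

omit [DecidableEq d]

/-- `2 ≤ ∞` in the smoothness exponents. [folklore] -/
theorem two_le_infty' : (2 : ℕ∞ω) ≤ ∞ := WithTop.coe_le_coe.mpr le_top

/-- `1 ≤ ∞` in the smoothness exponents. [folklore] -/
theorem one_le_infty' : (1 : ℕ∞ω) ≤ ∞ := WithTop.coe_le_coe.mpr le_top

/-- A directional derivative of a smooth function is smooth. [folklore] -/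
theorem contDiff_pd {f : Ed d → ℝ} (hf : ContDiff ℝ ∞ f) (v : Ed d) : ContDiff ℝ ∞ (pd v f) :=
  (hf.fderiv_right (m := ∞) (by norm_cast)).clm_apply contDiff_const

/-- A directional derivative of a `C¹` function is continuous. [folklore] -/
theorem continuous_pd {f : Ed d → ℝ} (hf : ContDiff ℝ 1 f) (v : Ed d) : Continuous (pd v f) :=
  (hf.continuous_fderiv one_ne_zero).clm_apply continuous_const

/-- Smooth functions are differentiable. [folklore] -/
theorem differentiable_of_smooth {f : Ed d → ℝ} (hf : ContDiff ℝ ∞ f) : Differentiable ℝ f :=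
  hf.differentiable (by simp)

omit [Fintype d] in
/-- Directional derivatives preserve compact support. [folklore] -/
theorem hasCompactSupport_pd {f : Ed d → ℝ} (hf : HasCompactSupport f) (v : Ed d) :
    HasCompactSupport (pd v f) :=
  hf.fderiv_apply (𝕜 := ℝ) v

omit [Fintype d] in
/-- The support of a directional derivative lies in the support of the function. [folklore] -/
theorem tsupport_pd_subset (v : Ed d) (f : Ed d → ℝ) : tsupport (pd v f) ⊆ tsupport f :=
  tsupport_fderiv_apply_subset ℝ v

omit [Fintype d] in
/-- A directional derivative vanishes off the support of the function. [folklore] -/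
theorem pd_eq_zero_of_notMem {f : Ed d → ℝ} {v x : Ed d} (hx : x ∉ tsupport f) : pd v f x = 0 :=
  image_eq_zero_of_notMem_tsupport fun h => hx (tsupport_pd_subset v f h)

/-- Mixed second derivatives of a `C²` function commute. [folklore] -/
theorem pd_comm {f : Ed d → ℝ} (hf : ContDiff ℝ 2 f) (a b : Ed d) : pd a (pd b f) = pd b (pd a f) := by
  funext x
  show fderiv ℝ (fun y => fderiv ℝ f y b) x a = fderiv ℝ (fun y => fderiv ℝ f y a) x b
  have hd : DifferentiableAt ℝ (fderiv ℝ f) x :=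
    ((hf.fderiv_right (m := 1) le_rfl).differentiable one_ne_zero) x
  have h22 : minSmoothness ℝ 2 ≤ (2 : ℕ∞ω) := by rw [minSmoothness_of_isRCLikeNormedField]
  have key : ∀ c e : Ed d, fderiv ℝ (fun y => fderiv ℝ f y c) x e = fderiv ℝ (fderiv ℝ f) x e c := by
    intro c e
    rw [fderiv_clm_apply hd (differentiableAt_const c)]
    simp
  rw [key, key]
  exact (hf.contDiffAt.isSymmSndFDerivAt h22).eq a b

/-- Mixed second derivatives of a smooth function commute. [folklore] -/
theorem pd_comm_smooth {f : Ed d → ℝ} (hf : ContDiff ℝ ∞ f) (a b : Ed d) :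
    pd a (pd b f) = pd b (pd a f) :=
  pd_comm (hf.of_le two_le_infty') a b

/-- `∂_v (f + g) = ∂_v f + ∂_v g`. [folklore] -/
theorem pd_add {f g : Ed d → ℝ} (hf : Differentiable ℝ f) (hg : Differentiable ℝ g) (v : Ed d) :
    pd v (fun x => f x + g x) = fun x => pd v f x + pd v g x := by
  funext x; simp only [pd, fderiv_fun_add (hf x) (hg x), _root_.add_apply]

/-- `∂_v (c f) = c ∂_v f`. [folklore] -/
theorem pd_const_mul {f : Ed d → ℝ} (hf : Differentiable ℝ f) (c : ℝ) (v : Ed d) :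
    pd v (fun x => c * f x) = fun x => c * pd v f x := by
  funext x; simp only [pd, fderiv_const_mul (hf x), _root_.smul_apply, smul_eq_mul]

omit [Fintype d] in
/-- Constants have vanishing derivatives. [folklore] -/
theorem pd_const (c : ℝ) (v : Ed d) : pd v (fun _ : Ed d => c) = fun _ => 0 := by
  funext x; simp [pd]

/-- Leibniz rule `∂_v (f g) = ∂_v f · g + f · ∂_v g`. [folklore] -/
theorem pd_mul {f g : Ed d → ℝ} (hf : Differentiable ℝ f) (hg : Differentiable ℝ g) (v : Ed d) :
    pd v (fun x => f x * g x) = fun x => pd v f x * g x + f x * pd v g x := by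
  funext x
  simp only [pd, fderiv_fun_mul (hf x) (hg x), _root_.add_apply, _root_.smul_apply, smul_eq_mul]
  ring

/-- `∂_v` of a finite sum. [folklore] -/
theorem pd_finset_sum {ι : Type*} (s : Finset ι) {f : ι → Ed d → ℝ}
    (hf : ∀ i ∈ s, Differentiable ℝ (f i)) (v : Ed d) :
    pd v (fun x => ∑ i ∈ s, f i x) = fun x => ∑ i ∈ s, pd v (f i) x := by
  funext x; simp only [pd, fderiv_fun_sum fun i hi => (hf i hi x), _root_.sum_apply]

omit [Fintype d] in
/-- `∂_v` is additive in the direction. [folklore] -/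
theorem pd_add_dir (v w : Ed d) (f : Ed d → ℝ) : pd (v + w) f = fun x => pd v f x + pd w f x := by
  funext x; simp [pd]

omit [Fintype d] in
/-- `∂_v` is homogeneous in the direction. [folklore] -/
theorem pd_smul_dir (c : ℝ) (v : Ed d) (f : Ed d → ℝ) : pd (c • v) f = fun x => c * pd v f x := by
  funext x; simp [pd]

/-- **Second-order Leibniz rule**:
`∂_a∂_b (χ g) = (∂_a∂_b χ) g + ∂_b χ ∂_a g + ∂_a χ ∂_b g + χ ∂_a∂_b g`. [folklore] -/
theorem pd_pd_mul {χ g : Ed d → ℝ} (hχ : ContDiff ℝ ∞ χ) (hg : ContDiff ℝ ∞ g) (a b : Ed d) :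
    pd a (pd b (fun x => χ x * g x)) = fun x =>
      pd a (pd b χ) x * g x + pd b χ x * pd a g x + pd a χ x * pd b g x + χ x * pd a (pd b g) x := by
  have hχd := differentiable_of_smooth hχ
  have hgd := differentiable_of_smooth hg
  have hχ' := differentiable_of_smooth (contDiff_pd hχ b)
  have hg' := differentiable_of_smooth (contDiff_pd hg b)
  have h1 : Differentiable ℝ (fun x => pd b χ x * g x) := hχ'.mul hgd
  have h2 : Differentiable ℝ (fun x => χ x * pd b g x) := hχd.mul hg'
  rw [pd_mul hχd hgd, pd_add h1 h2, pd_mul hχ' hgd, pd_mul hχd hg']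
  funext x; ring

/-! ### Derivatives along a linear phase -/

/-- The linear phase `x ↦ ⟪η, x⟫`. [folklore] -/
def phase (η : Ed d) : Ed d →L[ℝ] ℝ := innerSL ℝ η

/-- Formula for the phase. [folklore] -/
@[simp] theorem phase_apply (η x : Ed d) : phase η x = ⟪η, x⟫_ℝ := rfl

/-- A smooth profile of the phase is smooth. [folklore] -/
theorem contDiff_comp_phase {G : ℝ → ℝ} (hG : ContDiff ℝ ∞ G) (η : Ed d) :
    ContDiff ℝ ∞ fun x => G (phase η x) :=
  hG.comp (phase η).contDiff

/-- **Chain rule along the phase**: `∂_v (G ∘ φ_η) = ⟪η, v⟫ · G' ∘ φ_η`. [folklore] -/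
theorem pd_comp_phase {G : ℝ → ℝ} (hG : Differentiable ℝ G) (η v : Ed d) :
    pd v (fun x => G (phase η x)) = fun x => ⟪η, v⟫_ℝ * deriv G (phase η x) := by
  funext x
  rw [pd_apply]
  have h := ((hG (phase η x)).hasDerivAt.comp_hasFDerivAt x (phase η).hasFDerivAt).fderiv
  rw [show (fun x => G (phase η x)) = G ∘ ⇑(phase η) from rfl, h]
  simp [mul_comm]

/-- Second derivatives along the phase: `∂_a∂_b (G ∘ φ_η) = ⟪η,a⟫⟪η,b⟫ G'' ∘ φ_η`. [folklore] -/
theorem pd_pd_comp_phase {G : ℝ → ℝ} (hG : ContDiff ℝ ∞ G) (η a b : Ed d) :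
    pd a (pd b (fun x => G (phase η x))) =
      fun x => ⟪η, a⟫_ℝ * ⟪η, b⟫_ℝ * deriv (deriv G) (phase η x) := by
  have hGd : Differentiable ℝ G := hG.differentiable (by simp)
  have hG'd : Differentiable ℝ (deriv G) := (contDiff_infty_iff_deriv.mp hG).2.differentiable (by simp)
  have hd : Differentiable ℝ (fun x => deriv G (phase η x)) := hG'd.comp (phase η).differentiable
  rw [pd_comp_phase hGd, pd_const_mul hd, pd_comp_phase hG'd]
  funext x; ring

end Calculus

/-! ## Wave certificates and the coefficient tensors -/

variable (d) in
/-- A certified wave direction `w̄ = (v̄, S̄ - q Id)` ((3.1) of the paper): `η ≠ 0`, `v̄ · η = 0`,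
`S̄` symmetric with `S̄ η = 0` (here `S̄ = ū + q Id`). [cite: ChoffrutSzekelyhidi2014, (3.1)] -/
structure WaveCert where
  /-- the velocity amplitude `v̄` -/
  vbar : Ed d
  /-- the symmetric matrix `S̄ = ū + q Id` -/
  S : Matrix d d ℝ
  /-- the frequency direction `η` -/
  η : Ed d
  η_ne : η ≠ 0
  inner_vbar_η : ⟪vbar, η⟫_ℝ = 0
  S_isSymm : S.IsSymm
  S_mulVec_η : S *ᵥ (⇑η) = 0

namespace WaveCert

variable (c : WaveCert d)

omit [DecidableEq d] in
/-- `|η|² > 0`. [folklore] -/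
theorem normSq_pos : 0 < ‖c.η‖ ^ 2 := by
  have := norm_pos_iff.2 c.η_ne; positivity

/-- The antisymmetric matrix `ψ̄ = (v̄ ⊗ η - η ⊗ v̄)/|η|²` with `ψ̄ η = v̄`. [cite: ChoffrutSzekelyhidi2014, Lemma 3] -/
def psi (i k : d) : ℝ := (c.vbar i * c.η k - c.η i * c.vbar k) / ‖c.η‖ ^ 2

/-- The velocity coefficient tensor `P_{ikl} = ψ̄_{ik} η_l / |η|²`. [cite: ChoffrutSzekelyhidi2014, Lemma 3] -/
def P (i k l : d) : ℝ := c.psi i k * c.η l / ‖c.η‖ ^ 2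

/-- The stress coefficient tensor
`Φ_{ikjl} = (S̄_{ij} η_k η_l - S̄_{kj} η_i η_l - S̄_{il} η_k η_j + S̄_{kl} η_i η_j)/|η|⁴`.
[cite: ChoffrutSzekelyhidi2014, Lemma 3] -/
def Φ (i k j l : d) : ℝ :=
  (c.S i j * c.η k * c.η l - c.S k j * c.η i * c.η l - c.S i l * c.η k * c.η j +
    c.S k l * c.η i * c.η j) / (‖c.η‖ ^ 2) ^ 2

omit [DecidableEq d] in
/-- `ψ̄` is antisymmetric. [folklore] -/
theorem psi_antisymm (i k : d) : c.psi k i = -c.psi i k := by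
  unfold psi; ring

omit [DecidableEq d] in
/-- `P` is antisymmetric in its first two slots. [folklore] -/
theorem P_antisymm (i k l : d) : c.P k i l = -c.P i k l := by
  unfold P; rw [psi_antisymm]; ring

omit [DecidableEq d] in
/-- `Φ` is antisymmetric in the slots `(j, l)`. [folklore] -/
theorem Φ_antisymm (i k j l : d) : c.Φ i k l j = -c.Φ i k j l := by
  unfold Φ
  rw [c.S_isSymm.apply l k, c.S_isSymm.apply j k]
  ring

omit [DecidableEq d] in
/-- `Φ` is pair symmetric: `Φ_{jlik} = Φ_{ikjl}`. [folklore] -/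
theorem Φ_pair_symm (i k j l : d) : c.Φ j l i k = c.Φ i k j l := by
  unfold Φ
  rw [c.S_isSymm.apply i j, c.S_isSymm.apply i l, c.S_isSymm.apply k j, c.S_isSymm.apply k l]
  ring

omit [DecidableEq d] in
/-- `Σ_k η_k² = |η|²`. [folklore] -/
theorem sum_η_sq : ∑ k, c.η k ^ 2 = ‖c.η‖ ^ 2 := by
  rw [EuclideanSpace.norm_sq_eq]; simp [Real.norm_eq_abs, sq_abs]

omit [DecidableEq d] in
/-- `Σ_k v̄_k η_k = 0`. [folklore] -/
theorem sum_vbar_η : ∑ k, c.vbar k * c.η k = 0 := by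
  have h := c.inner_vbar_η
  rw [PiLp.inner_apply] at h
  simpa [mul_comm] using h

omit [DecidableEq d] in
/-- `Σ_l S̄_{kl} η_l = 0`. [folklore] -/
theorem sum_S_η (k : d) : ∑ l, c.S k l * c.η l = 0 := by
  have h := congrFun c.S_mulVec_η k
  simpa [Matrix.mulVec, dotProduct] using h

omit [DecidableEq d] in
/-- `Σ_k η_k S̄_{kl} = 0`. [folklore] -/
theorem sum_η_S (l : d) : ∑ k, c.η k * c.S k l = 0 := by
  rw [← c.sum_S_η l]
  exact Finset.sum_congr rfl fun k _ => by rw [c.S_isSymm.apply k l, mul_comm]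

omit [DecidableEq d] in
/-- **Velocity contraction**: `Σ_{k,l} P_{ikl} η_k η_l = v̄_i`. [cite: ChoffrutSzekelyhidi2014, Lemma 3] -/
theorem sum_P_η_η (i : d) : ∑ k, ∑ l, c.P i k l * c.η k * c.η l = c.vbar i := by
  have hn := c.normSq_pos.ne'
  have h1 : ∀ k, ∑ l, c.P i k l * c.η k * c.η l = c.psi i k * c.η k := by
    intro k
    have : ∀ l, c.P i k l * c.η k * c.η l = c.psi i k * c.η k / ‖c.η‖ ^ 2 * c.η l ^ 2 := by
      intro l; unfold P; ring
    simp_rw [this]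
    rw [← Finset.mul_sum, sum_η_sq, div_mul_cancel₀ _ hn]
  simp_rw [h1]
  have : ∀ k, c.psi i k * c.η k =
      (c.vbar i / ‖c.η‖ ^ 2) * c.η k ^ 2 - (c.η i / ‖c.η‖ ^ 2) * (c.vbar k * c.η k) := by
    intro k; unfold psi; ring
  simp_rw [this]
  rw [Finset.sum_sub_distrib, ← Finset.mul_sum, ← Finset.mul_sum, sum_η_sq, sum_vbar_η,
    mul_zero, sub_zero, div_mul_cancel₀ _ hn]

omit [DecidableEq d] in
/-- **Stress contraction**: `Σ_{k,l} Φ_{ikjl} η_k η_l = S̄_{ij}`. [cite: ChoffrutSzekelyhidi2014, Lemma 3] -/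
theorem sum_Φ_η_η (i j : d) : ∑ k, ∑ l, c.Φ i k j l * c.η k * c.η l = c.S i j := by
  have hn := c.normSq_pos.ne'
  have e : ∀ k l, c.Φ i k j l * c.η k * c.η l =
      (c.S i j * c.η k ^ 2 / (‖c.η‖ ^ 2) ^ 2) * c.η l ^ 2
      - (c.η i * (c.η k * c.S k j) / (‖c.η‖ ^ 2) ^ 2) * c.η l ^ 2
      - (c.η j * c.η k ^ 2 / (‖c.η‖ ^ 2) ^ 2) * (c.S i l * c.η l)
      + (c.η i * c.η j * c.η k / (‖c.η‖ ^ 2) ^ 2) * (c.S k l * c.η l) := by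
    intro k l; unfold Φ; ring
  have inner : ∀ k, ∑ l, c.Φ i k j l * c.η k * c.η l =
      (c.S i j / ‖c.η‖ ^ 2) * c.η k ^ 2 - (c.η i / ‖c.η‖ ^ 2) * (c.η k * c.S k j) := by
    intro k
    simp_rw [e k]
    rw [Finset.sum_add_distrib, Finset.sum_sub_distrib, Finset.sum_sub_distrib, ← Finset.mul_sum,
      ← Finset.mul_sum, ← Finset.mul_sum, ← Finset.mul_sum, sum_η_sq, sum_S_η, sum_S_η]
    have hn' : ‖c.η‖ ≠ 0 := norm_ne_zero_iff.2 c.η_ne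
    field_simp
    ring
  simp_rw [inner]
  rw [Finset.sum_sub_distrib, ← Finset.mul_sum, ← Finset.mul_sum, sum_η_sq, sum_η_S, mul_zero,
    sub_zero, div_mul_cancel₀ _ hn]

/-! ## The operator `𝓛_w̄` -/

/-- Velocity component `v_i = Σ_{k,l} P_{ikl} ∂_k∂_l φ`. [cite: ChoffrutSzekelyhidi2014, Lemma 3] -/
def velPot (φ : Ed d → ℝ) (i : d) (x : Ed d) : ℝ := ∑ k, ∑ l, c.P i k l * pd (eb k) (pd (eb l) φ) x

/-- Symmetric divergence-free part `S_{ij} = Σ_{k,l} Φ_{ikjl} ∂_k∂_l φ`. [cite: ChoffrutSzekelyhidi2014, Lemma 3] -/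
def strS (φ : Ed d → ℝ) (i j : d) (x : Ed d) : ℝ := ∑ k, ∑ l, c.Φ i k j l * pd (eb k) (pd (eb l) φ) x

/-- Stress component `u_{ij} = S_{ij} - (tr S / d) δ_{ij}`. [cite: ChoffrutSzekelyhidi2014, Lemma 3] -/
def strPot (φ : Ed d → ℝ) (i j : d) (x : Ed d) : ℝ :=
  c.strS φ i j x - if i = j then (∑ m, c.strS φ m m x) / Fintype.card d else 0

/-- The state-valued field `𝓛_w̄[φ] = (v, u)`. [cite: ChoffrutSzekelyhidi2014, Lemma 3] -/
def field (φ : Ed d → ℝ) (x : Ed d) : State d :=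
  mkSt (WithLp.toLp 2 fun i => c.velPot φ i x) (Matrix.of fun i j => c.strPot φ i j x)

/-- Velocity components of the field. [folklore] -/
@[simp] theorem vel_field (φ : Ed d → ℝ) (x : Ed d) (i : d) : vel (c.field φ x) i = c.velPot φ i x := rfl

/-- Stress components of the field. [folklore] -/
@[simp] theorem str_field (φ : Ed d → ℝ) (x : Ed d) (i j : d) :
    str (c.field φ x) i j = c.strPot φ i j x := rfl

/-- Coordinates of the field. [folklore] -/
theorem field_apply_inl (φ : Ed d → ℝ) (x : Ed d) (i : d) :
    c.field φ x (Sum.inl i) = c.velPot φ i x := rfl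

/-- Coordinates of the field. [folklore] -/
theorem field_apply_inr (φ : Ed d → ℝ) (x : Ed d) (p : d × d) :
    c.field φ x (Sum.inr p) = c.strPot φ p.1 p.2 x := rfl

/-! ### Smoothness and support -/

section Smooth

variable {φ : Ed d → ℝ}

omit [DecidableEq d] in
/-- Second derivatives of smooth functions are smooth. [folklore] -/
theorem contDiff_pd_pd (hφ : ContDiff ℝ ∞ φ) (a b : Ed d) : ContDiff ℝ ∞ (pd a (pd b φ)) :=
  contDiff_pd (contDiff_pd hφ b) a

/-- The velocity components are smooth. [folklore] -/
theorem contDiff_velPot (hφ : ContDiff ℝ ∞ φ) (i : d) : ContDiff ℝ ∞ (c.velPot φ i) := by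
  unfold velPot
  exact ContDiff.sum fun k _ => ContDiff.sum fun l _ => contDiff_const.mul (contDiff_pd_pd hφ _ _)

/-- The `S`-components are smooth. [folklore] -/
theorem contDiff_strS (hφ : ContDiff ℝ ∞ φ) (i j : d) : ContDiff ℝ ∞ (c.strS φ i j) := by
  unfold strS
  exact ContDiff.sum fun k _ => ContDiff.sum fun l _ => contDiff_const.mul (contDiff_pd_pd hφ _ _)

/-- The stress components are smooth. [folklore] -/
theorem contDiff_strPot (hφ : ContDiff ℝ ∞ φ) (i j : d) : ContDiff ℝ ∞ (c.strPot φ i j) := by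
  unfold strPot
  refine (c.contDiff_strS hφ i j).sub ?_
  split_ifs
  · exact (ContDiff.sum fun m _ => c.contDiff_strS hφ m m).div_const _
  · exact contDiff_const

/-- The coordinates of the field are smooth. [folklore] -/
theorem contDiff_field_apply (hφ : ContDiff ℝ ∞ φ) (κ : Idx d) : ContDiff ℝ ∞ fun x => c.field φ x κ := by
  rcases κ with i | ⟨i, j⟩
  · exact c.contDiff_velPot hφ i
  · exact c.contDiff_strPot hφ i j

/-- The field is smooth as a state-valued map. [folklore] -/
theorem contDiff_field (hφ : ContDiff ℝ ∞ φ) : ContDiff ℝ ∞ (c.field φ) :=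
  contDiff_piLp' 2 fun κ => c.contDiff_field_apply hφ κ

/-- The field is continuous. [folklore] -/
theorem continuous_field (hφ : ContDiff ℝ ∞ φ) : Continuous (c.field φ) := (c.contDiff_field hφ).continuous

omit [Fintype d] [DecidableEq d] in
/-- Second derivatives vanish off the support. [folklore] -/
theorem pd_pd_eq_zero_of_notMem {x : Ed d} (hx : x ∉ tsupport φ) (a b : Ed d) : pd a (pd b φ) x = 0 :=
  pd_eq_zero_of_notMem fun h => hx (tsupport_pd_subset b φ h)

/-- The field vanishes off the support of the potential. [folklore] -/
theorem field_eq_zero_of_notMem {x : Ed d} (hx : x ∉ tsupport φ) : c.field φ x = 0 := by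
  have hv : ∀ i, c.velPot φ i x = 0 := fun i => by
    unfold velPot; simp [pd_pd_eq_zero_of_notMem hx]
  have hs : ∀ i j, c.strS φ i j x = 0 := fun i j => by
    unfold strS; simp [pd_pd_eq_zero_of_notMem hx]
  have hu : ∀ i j, c.strPot φ i j x = 0 := fun i j => by
    unfold strPot; simp [hs]
  ext κ; rcases κ with i | ⟨i, j⟩
  · simp [field_apply_inl, hv]
  · simp [field_apply_inr, hu]

/-- The support of the field lies in the support of the potential. [folklore] -/
theorem tsupport_field_subset (φ : Ed d → ℝ) : tsupport (c.field φ) ⊆ tsupport φ := by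
  refine closure_minimal (fun x hx => ?_) (isClosed_tsupport φ)
  by_contra h
  exact hx (c.field_eq_zero_of_notMem h)

/-- The field of a compactly supported potential is compactly supported. [folklore] -/
theorem hasCompactSupport_field (hφc : HasCompactSupport φ) : HasCompactSupport (c.field φ) :=
  IsCompact.of_isClosed_subset hφc (isClosed_tsupport _) (c.tsupport_field_subset φ)

end Smooth

/-! ### The conservation laws and admissibility -/

section Laws

variable {φ : Ed d → ℝ}

omit [DecidableEq d] in
/-- Differentiating a double sum with constant coefficients. [folklore] -/
theorem pd_sum_sum_const_mul (v : Ed d) (A : d → d → ℝ) {F : d → d → Ed d → ℝ}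
    (hF : ∀ k l, Differentiable ℝ (F k l)) :
    pd v (fun x => ∑ k, ∑ l, A k l * F k l x) = fun x => ∑ k, ∑ l, A k l * pd v (F k l) x := by
  have h1 : ∀ k, Differentiable ℝ (fun x => ∑ l, A k l * F k l x) :=
    fun k => Differentiable.fun_sum fun l _ => (differentiable_const _).mul (hF k l)
  rw [pd_finset_sum _ fun k _ => h1 k]
  funext x
  refine Finset.sum_congr rfl fun k _ => ?_
  have h2 : ∀ l ∈ (Finset.univ : Finset d), Differentiable ℝ (fun x => A k l * F k l x) :=
    fun l _ => (differentiable_const _).mul (hF k l)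
  rw [pd_finset_sum _ h2]
  refine Finset.sum_congr rfl fun l _ => ?_
  rw [pd_const_mul (hF k l)]

omit [Fintype d] [DecidableEq d] in
/-- An antisymmetric array against a symmetric one sums to zero. [folklore] -/
theorem sum_sum_antisymm_mul_symm [Fintype d] {A B : d → d → ℝ} (hA : ∀ i k, A k i = -A i k)
    (hB : ∀ i k, B k i = B i k) : ∑ i, ∑ k, A i k * B i k = 0 := by
  have h : ∑ i, ∑ k, A i k * B i k = -∑ i, ∑ k, A i k * B i k := by
    conv_lhs => rw [Finset.sum_comm]
    rw [← Finset.sum_neg_distrib]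
    refine Finset.sum_congr rfl fun i _ => ?_
    rw [← Finset.sum_neg_distrib]
    refine Finset.sum_congr rfl fun k _ => ?_
    rw [hA i k, hB i k]; ring
  linarith

/-- **`div v = 0`** pointwise: `Σ_i ∂_i v_i = 0` (antisymmetry of `ψ̄` against the symmetry of
second derivatives). [cite: ChoffrutSzekelyhidi2014, Lemma 3] -/
theorem div_velPot (hφ : ContDiff ℝ ∞ φ) (x : Ed d) : ∑ i, pd (eb i) (c.velPot φ i) x = 0 := by
  have hdiff : ∀ k l, Differentiable ℝ (pd (eb k) (pd (eb l) φ)) :=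
    fun k l => differentiable_of_smooth (contDiff_pd_pd hφ _ _)
  have hexp : ∀ i, pd (eb i) (c.velPot φ i) x =
      ∑ k, ∑ l, c.P i k l * pd (eb i) (pd (eb k) (pd (eb l) φ)) x := fun i =>
    congrFun (pd_sum_sum_const_mul (eb i) (c.P i) hdiff) x
  simp_rw [hexp]
  -- reorder to `Σ_l Σ_i Σ_k`
  have hswap : ∀ i, ∑ k, ∑ l, c.P i k l * pd (eb i) (pd (eb k) (pd (eb l) φ)) x =
      ∑ l, ∑ k, c.P i k l * pd (eb i) (pd (eb k) (pd (eb l) φ)) x := fun i => Finset.sum_comm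
  simp_rw [hswap]
  rw [Finset.sum_comm]
  refine Finset.sum_eq_zero fun l _ => ?_
  refine sum_sum_antisymm_mul_symm (fun i k => c.P_antisymm i k l) fun i k => ?_
  show pd (eb k) (pd (eb i) (pd (eb l) φ)) x = pd (eb i) (pd (eb k) (pd (eb l) φ)) x
  rw [pd_comm_smooth (contDiff_pd hφ _) (eb k) (eb i)]

/-- **`div S = 0`** row-wise and pointwise: `Σ_j ∂_j S_{ij} = 0` (antisymmetry of `Φ` in `(j,l)`).
[cite: ChoffrutSzekelyhidi2014, Lemma 3] -/
theorem div_strS (hφ : ContDiff ℝ ∞ φ) (i : d) (x : Ed d) : ∑ j, pd (eb j) (c.strS φ i j) x = 0 := by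
  have hdiff : ∀ k l, Differentiable ℝ (pd (eb k) (pd (eb l) φ)) :=
    fun k l => differentiable_of_smooth (contDiff_pd_pd hφ _ _)
  have hexp : ∀ j, pd (eb j) (c.strS φ i j) x =
      ∑ k, ∑ l, c.Φ i k j l * pd (eb j) (pd (eb k) (pd (eb l) φ)) x := fun j =>
    congrFun (pd_sum_sum_const_mul (eb j) (fun k l => c.Φ i k j l) hdiff) x
  simp_rw [hexp]
  rw [Finset.sum_comm]
  refine Finset.sum_eq_zero fun k _ => ?_
  refine sum_sum_antisymm_mul_symm (fun j l => c.Φ_antisymm i k j l) fun j l => ?_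
  show pd (eb l) (pd (eb k) (pd (eb j) φ)) x = pd (eb j) (pd (eb k) (pd (eb l) φ)) x
  rw [pd_comm_smooth hφ (eb k) (eb j), pd_comm_smooth (contDiff_pd hφ _) (eb l) (eb j),
    pd_comm_smooth hφ (eb l) (eb k)]

/-- `S` is symmetric. [cite: ChoffrutSzekelyhidi2014, Lemma 3] -/
theorem strS_symm (hφ : ContDiff ℝ ∞ φ) (i j : d) (x : Ed d) : c.strS φ j i x = c.strS φ i j x := by
  unfold strS
  rw [Finset.sum_comm]
  refine Finset.sum_congr rfl fun k _ => Finset.sum_congr rfl fun l _ => ?_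
  rw [c.Φ_pair_symm, pd_comm_smooth hφ (eb l) (eb k)]

/-- The stress `u = S - (tr S/d) Id` is symmetric. [folklore] -/
theorem strPot_symm (hφ : ContDiff ℝ ∞ φ) (i j : d) (x : Ed d) : c.strPot φ j i x = c.strPot φ i j x := by
  unfold strPot
  rw [c.strS_symm hφ i j x]
  by_cases h : i = j
  · subst h; rfl
  · rw [if_neg h, if_neg (Ne.symm h)]

/-- The stress is trace free. [folklore] -/
theorem trace_strPot [Nonempty d] (φ : Ed d → ℝ) (x : Ed d) : ∑ i, c.strPot φ i i x = 0 := by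
  unfold strPot
  simp only [if_true, Finset.sum_sub_distrib, Finset.sum_const, Finset.card_univ, nsmul_eq_mul]
  have hc : (Fintype.card d : ℝ) ≠ 0 := by exact_mod_cast Fintype.card_ne_zero
  field_simp
  ring

/-- **The values of `𝓛_w̄[φ]` are admissible states.** [cite: ChoffrutSzekelyhidi2014, Lemma 3] -/
theorem isAdm_field [Nonempty d] (hφ : ContDiff ℝ ∞ φ) (x : Ed d) : IsAdm (c.field φ x) := by
  refine ⟨?_, ?_⟩
  · ext i j
    simp only [Matrix.transpose_apply, str_field]
    exact c.strPot_symm hφ i j x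
  · simp only [Matrix.trace, Matrix.diag_apply, str_field]
    exact c.trace_strPot φ x

end Laws

/-! ### The plane-wave identities -/

section PlaneWave

/-- The direction state `w̄ = (v̄, S̄ - (tr S̄ / d) Id) = (v̄, ū)` carried by the certificate
(`ū = S̄ - q Id`, `q = tr S̄ / d`). [cite: ChoffrutSzekelyhidi2014, Lemma 3] -/
def dir : State d :=
  mkSt c.vbar (c.S - ((c.S.trace / Fintype.card d) : ℝ) • (1 : Matrix d d ℝ))

/-- **Plane-wave identity (pointwise form of `𝓛_w̄[H(x·η)] = w̄ H''`).** If at `x` all second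
derivatives of `φ` are `∂_k∂_l φ (x) = η_k η_l h`, then `𝓛_w̄[φ](x) = h • w̄`.
[cite: ChoffrutSzekelyhidi2014, Lemma 3] -/
theorem field_eq_smul_dir_of {φ : Ed d → ℝ} {x : Ed d} {h : ℝ}
    (hφ : ∀ k l, pd (eb k) (pd (eb l) φ) x = c.η k * c.η l * h) : c.field φ x = h • c.dir := by
  have hv : ∀ i, c.velPot φ i x = h * c.vbar i := by
    intro i
    unfold velPot
    simp_rw [hφ]
    rw [← c.sum_P_η_η i, Finset.mul_sum]
    refine Finset.sum_congr rfl fun k _ => ?_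
    rw [Finset.mul_sum]
    refine Finset.sum_congr rfl fun l _ => ?_
    ring
  have hs : ∀ i j, c.strS φ i j x = h * c.S i j := by
    intro i j
    unfold strS
    simp_rw [hφ]
    rw [← c.sum_Φ_η_η i j, Finset.mul_sum]
    refine Finset.sum_congr rfl fun k _ => ?_
    rw [Finset.mul_sum]
    refine Finset.sum_congr rfl fun l _ => ?_
    ring
  refine ext_vel_str ?_ ?_
  · ext i
    rw [vel_field, hv, dir, vel_smul, vel_mkSt, PiLp.smul_apply, smul_eq_mul]
  · ext i j
    rw [str_field, dir, str_smul, str_mkSt, Matrix.smul_apply, Matrix.sub_apply, Matrix.smul_apply,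
      strPot, hs]
    simp_rw [hs]
    rw [← Finset.mul_sum, Matrix.trace]
    simp only [Matrix.diag_apply, smul_eq_mul, Matrix.one_apply]
    split_ifs <;> ring

/-- For a pure plane wave `φ = G(⟪η, ·⟫)`: `𝓛_w̄[φ] = (G'' ∘ ⟪η,·⟫) • w̄`.
[cite: ChoffrutSzekelyhidi2014, Lemma 3] -/
theorem field_comp_phase {G : ℝ → ℝ} (hG : ContDiff ℝ ∞ G) (x : Ed d) :
    c.field (fun y => G (phase c.η y)) x = deriv (deriv G) (phase c.η x) • c.dir := by
  refine c.field_eq_smul_dir_of fun k l => ?_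
  rw [pd_pd_comp_phase hG]
  simp [EuclideanSpace.inner_single_right]

end PlaneWave

end WaveCert

end StationaryEuler

end Literature.Analysis.FluidPDE
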